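import Summits.BirchSwinnertonDyer.BirchSwinnertonDyer.Theorems.ManinLocalTwoThreeIstarJValuation
import HarnessLib

/-!
# The component window at an additive place over `ℚ`: `m_p = ord_p Δ_min − ord_p N + 1`; at `3`: potentially good ⟹ `1 ≤ m₃ ≤ 9`
# (S-an-42 / S-an-42′) and `27 ∣ N` ⟹ `m₃ ∈ {1, 3, 7, 9}` (S-an-43)

Summit `BirchSwinnertonDyer`, route `ManinLocalTwoThree` (cell bsd-f2-manin), crux C3 `ManinPrimeToThreeAtNine` (stmt-BirchSwinnertonDyer-22968)
(and C2 `ManinOddAtFour`, stmt-…-22967, for the prime-uniform dictionary).  an's clock law at `3` (E-an-116 `ThreeNeronScalarClockLaw`,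
MEMO-an §67) is stated with `m = oggComponents 3 W := ord₃ Δ_min − ord₃ N + 1` and consumes the support rows S-an-42
`PotGoodComponentWindowThree` («`9 ∣ N`, `ord₃ j ≥ 0` ⟹ `1 ≤ m ≤ 9`», in print: Kraus 1990 / Papadopoulos 1993 Table II) and S-an-43
`WildThreeKodairaTypes` («`27 ∣ N`, `ord₃ j ≥ 0` ⟹ `m ∈ {1, 3, 7, 9}`», DD15 Thm 6 ⟸ Kraus).  Both are theorems of Tate's algorithm as
implemented in the tree; this file records them BY VALUE (`oggComponents` unfolded, Sketch-an-g25 :237/:248 and Sketch-an-g25b :57):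

* §1 `oggComponents_eq_numComponents_of_sq_dvd` (any prime `p`, `p² ∣ N`, `W` globally minimal): the integer `ord_p Δ_min − ord_p N + 1`
  IS `m_p`, the number of components of the (additive) Kodaira type at `p` — Ogg's formula `f = ord Δ_min + 1 − m` being the tree's
  DEFINITION of `conductorExponent`, with `m ≤ ord Δ_min + 1` (`numComponentsAt_le_holds`); `eq_of_isAdditive`: the seven additive types.
* §2 at `3`: `numComponents_le_nine_of_potGood_three` (additive at `3`, `ord₃ j ≥ 0` ⟹ `m₃ ≤ 9`: the only additive type with `m > 9` is
  `Iₙ*`, `n ≥ 5`, and `Iₙ*` with `n ≥ 1` has `ord₃ j = −n < 0`, p3-g7's `padicValRat_three_j_eq_neg_of_kodairaSymbolAt_Istar_succ`);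
  `numComponents_of_twentyseven_dvd` (`27 ∣ N` ⟹ type `II, IV, IV*, II*`, `m ∈ {1, 3, 7, 9}`, NO `ord₃ j` hypothesis: `III`, `III*`, `Iₙ*`
  have `f₃ = 2` by the tree's `conductorExponent_eq_two_of_kodairaSymbolAt`); and BY VALUE: **`potGoodComponentWindowThree`** (S-an-42),
  **`potSupersingularComponentBoundThree`** (S-an-42′), **`wildThreeKodairaTypes`** (S-an-43, hypothesis `ord₃ j ≥ 0` idle).

HONEST FRAMING: local structure theorems (classification facts, in print); E-an-116 itself is not proved here (it also needs conductor
invariance along the isogeny); C3, Manin's conjecture and BSD are not proved.  No definitions, no named facts, no sorry.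
References: [SilvermanATAEC1994] IV.9.4 Table 4.1, IV.11.1; [Kraus1990] Thm 1 (p = 3); [Papadopoulos1993] Table II; [DokchitserDokchitser2015LocalInvariants]
Thm 6.
-/

set_option linter.dupNamespace false
set_option autoImplicit false

noncomputable section

open scoped Classical

open WeierstrassCurve IsDedekindDomain IsLocalRing
  Literature.NumberTheory.DiophantineGeometry Literature.NumberTheory.DiophantineGeometry.TateAlgorithm
  Literature.NumberTheory.EllipticCurves

namespace Summit.BirchSwinnertonDyer.BirchSwinnertonDyer.Theorems.ManinLocalTwoThree

open NumberField Rat.HeightOneSpectrum Summit.BirchSwinnertonDyer.Rank1Residual.Additive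

/-! ### §1 The dictionary `ord_p Δ_min − ord_p N + 1 = m_p` at an additive prime -/

/-- **The seven additive Kodaira types.** [cite: SilvermanATAEC1994, IV.9.4 Table 4.1] -/
theorem eq_of_isAdditive {k : KodairaSymbol} (hk : k.IsAdditive) :
    k = .II ∨ k = .III ∨ k = .IV ∨ (∃ N, k = .Istar N) ∨ k = .IVstar ∨ k = .IIIstar ∨ k = .IIstar := by
  obtain ⟨hg, hm⟩ := hk
  rcases k with (_ | n) | _ | _ | _ | N | _ | _ | _
  · exact absurd rfl hg
  · exact absurd ⟨n + 1, Nat.succ_ne_zero n, rfl⟩ hm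
  all_goals simp

/-- **Ogg's `m_p` in the global currency:** for a globally minimal `W/ℚ` and a prime `p` with `p² ∣ N`, the integer
`ord_p Δ_min − ord_p N + 1` (an's `oggComponents p W`) IS the number of components of the Kodaira type at `p`, which is additive
(`f_p = ord_p Δ_min + 1 − m_p` is the tree's definition of `conductorExponent`; `m_p ≤ ord_p Δ_min + 1` by `numComponentsAt_le_holds`;
`f_p ≥ 2 ⟺` additive). [cite: SilvermanATAEC1994, IV.10.2 and IV.11.1] -/
theorem oggComponents_eq_numComponents_of_sq_dvd (W : WeierstrassCurve ℚ) [W.IsElliptic] [W.IsGloballyMinimal] (p : ℕ) [hp : Fact p.Prime]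
    (hp2 : p ^ 2 ∣ W.conductorNorm ℤ) :
    ((padicValInt p W.minimalDiscriminantInt : ℕ) : ℤ) - (padicValNat p (W.conductorNorm ℤ) : ℤ) + 1 =
        ((W.kodairaSymbolAt (placeOf p)).numComponents : ℤ) ∧ (W.kodairaSymbolAt (placeOf p)).IsAdditive := by
  haveI : PerfectField (IsLocalRing.ResidueField ((placeOf p).adicCompletionIntegers ℚ)) := PerfectField.ofFinite
  have hN0 : W.conductorNorm ℤ ≠ 0 := (W.conductorNorm_pos_holds).ne'
  have hfac : (W.conductorNorm ℤ).factorization p = W.conductorExponent (placeOf p) :=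
    factorization_conductorNorm_primesEquiv_symm W ⟨p, hp.out⟩
  have hval : padicValNat p (W.conductorNorm ℤ) = W.conductorExponent (placeOf p) := by
    rw [← hfac, Nat.factorization_def _ hp.out]
  have h2f : 2 ≤ W.conductorExponent (placeOf p) := by
    rw [← hfac]; exact (hp.out.pow_dvd_iff_le_factorization hN0).mp hp2
  have hadd : (W.kodairaSymbolAt (placeOf p)).IsAdditive :=
    (isAdditive_kodairaSymbolAt_iff_holds (placeOf p) W).mpr ((two_le_conductorExponent_iff_holds (placeOf p) W).mp h2f)
  have hle : W.numComponentsAt (placeOf p) ≤ W.ordMinimalDiscriminant (placeOf p) + 1 := numComponentsAt_le_holds (placeOf p) W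
  have hδ : W.ordMinimalDiscriminant (placeOf p) = padicValInt p W.minimalDiscriminantInt := ordMinimalDiscriminant_placeOf_eq W p
  refine ⟨?_, hadd⟩
  have hf : W.conductorExponent (placeOf p) = W.ordMinimalDiscriminant (placeOf p) + 1 - W.numComponentsAt (placeOf p) := rfl
  unfold numComponentsAt at hle hf
  rw [hval, ← hδ, hf]
  push_cast [hle]
  ring

/-- `1 ≤ ord_p Δ_min − ord_p N + 1` at every prime with `p² ∣ N` (every Kodaira type has a component). [cite: SilvermanATAEC1994, IV.11.1] -/
theorem one_le_oggComponents_of_sq_dvd (W : WeierstrassCurve ℚ) [W.IsElliptic] [W.IsGloballyMinimal] (p : ℕ) [Fact p.Prime]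
    (hp2 : p ^ 2 ∣ W.conductorNorm ℤ) :
    1 ≤ ((padicValInt p W.minimalDiscriminantInt : ℕ) : ℤ) - (padicValNat p (W.conductorNorm ℤ) : ℤ) + 1 := by
  rw [(oggComponents_eq_numComponents_of_sq_dvd W p hp2).1]
  exact_mod_cast (W.kodairaSymbolAt (placeOf p)).numComponents_pos

/-! ### §2 At `3`: the potentially good window and the wild types -/

/-- **Additive and potentially good at `3` ⟹ `m₃ ≤ 9`:** the only additive type with more than `9` components is `Iₙ*` (`n ≥ 5`), and at
`3` type `Iₙ*` with `n ≥ 1` is potentially multiplicative (`ord₃ j = −n`). [cite: SilvermanATAEC1994, IV.9.4 Step 7 and Table 4.1] -/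
theorem numComponents_le_nine_of_potGood_three (W : WeierstrassCurve ℚ) [W.IsElliptic]
    (hadd : (W.kodairaSymbolAt (placeOf 3)).IsAdditive) (hj : 0 ≤ padicValRat 3 W.j) :
    (W.kodairaSymbolAt (placeOf 3)).numComponents ≤ 9 := by
  rcases eq_of_isAdditive hadd with h | h | h | ⟨N, h⟩ | h | h | h
  all_goals try (rw [h]; simp [KodairaSymbol.numComponents])
  rcases N with _ | n
  · simp
  · have := padicValRat_three_j_eq_neg_of_kodairaSymbolAt_Istar_succ W h
    exfalso; linarith

/-- **`27 ∣ N` ⟹ type `II`, `IV`, `IV*` or `II*` at `3`** (`m₃ ∈ {1, 3, 7, 9}`; the types `III`, `III*`, `Iₙ*` have `f₃ = 2` at a place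
of residue characteristic `≠ 2`, `conductorExponent_eq_two_of_kodairaSymbolAt`). No hypothesis on `j`. [cite: SilvermanATAEC1994, IV.9.4 Table 4.1 and IV.11.1]
[cite: DokchitserDokchitser2015LocalInvariants, Thm 6] -/
theorem kodairaSymbolAt_of_twentyseven_dvd (W : WeierstrassCurve ℚ) [W.IsElliptic] (h27 : 3 ^ 3 ∣ W.conductorNorm ℤ) :
    W.kodairaSymbolAt (placeOf 3) = .II ∨ W.kodairaSymbolAt (placeOf 3) = .IV ∨
      W.kodairaSymbolAt (placeOf 3) = .IVstar ∨ W.kodairaSymbolAt (placeOf 3) = .IIstar := by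
  haveI : PerfectField (IsLocalRing.ResidueField ((placeOf 3).adicCompletionIntegers ℚ)) := PerfectField.ofFinite
  have hN0 : W.conductorNorm ℤ ≠ 0 := (W.conductorNorm_pos_holds).ne'
  have hfac : (W.conductorNorm ℤ).factorization 3 = W.conductorExponent (placeOf 3) :=
    factorization_conductorNorm_primesEquiv_symm W ⟨3, Nat.prime_three⟩
  have h3f : 3 ≤ W.conductorExponent (placeOf 3) := by
    rw [← hfac]; exact (Nat.prime_three.pow_dvd_iff_le_factorization hN0).mp h27
  have hadd : (W.kodairaSymbolAt (placeOf 3)).IsAdditive :=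
    (isAdditive_kodairaSymbolAt_iff_holds (placeOf 3) W).mpr ((two_le_conductorExponent_iff_holds (placeOf 3) W).mp (by omega))
  have h2 : ringChar (ℤ ⧸ (placeOf 3).asIdeal) ≠ 2 := by rw [ringChar_int_quot_placeOf 3]; decide
  have htame : ∀ (hT : W.kodairaSymbolAt (placeOf 3) = .III ∨ W.kodairaSymbolAt (placeOf 3) = .IIIstar ∨
      ∃ n, W.kodairaSymbolAt (placeOf 3) = .Istar n), False := fun hT ↦ by
    have := W.conductorExponent_eq_two_of_kodairaSymbolAt (placeOf 3) h2 hT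
    omega
  rcases eq_of_isAdditive hadd with h | h | h | ⟨N, h⟩ | h | h | h
  · exact Or.inl h
  · exact (htame (Or.inl h)).elim
  · exact Or.inr (Or.inl h)
  · exact (htame (Or.inr (Or.inr ⟨N, h⟩))).elim
  · exact Or.inr (Or.inr (Or.inl h))
  · exact (htame (Or.inr (Or.inl h))).elim
  · exact Or.inr (Or.inr (Or.inr h))

/-- **`27 ∣ N` ⟹ `m₃ ∈ {1, 3, 7, 9}`.** [cite: SilvermanATAEC1994, IV.9.4 Table 4.1] -/
theorem numComponents_of_twentyseven_dvd (W : WeierstrassCurve ℚ) [W.IsElliptic] (h27 : 3 ^ 3 ∣ W.conductorNorm ℤ) :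
    (W.kodairaSymbolAt (placeOf 3)).numComponents = 1 ∨ (W.kodairaSymbolAt (placeOf 3)).numComponents = 3 ∨
      (W.kodairaSymbolAt (placeOf 3)).numComponents = 7 ∨ (W.kodairaSymbolAt (placeOf 3)).numComponents = 9 := by
  rcases kodairaSymbolAt_of_twentyseven_dvd W h27 with h | h | h | h <;> rw [h] <;> simp [KodairaSymbol.numComponents]

/-- **S-an-42 `PotGoodComponentWindowThree` BY VALUE** (an g25, Sketch-an-g25 :248, `oggComponents 3 W` unfolded; in print: Kraus 1990 Thm 1 /
Papadopoulos 1993 Table II — no potentially good `Iₙ*`, `n ≥ 1`, at `3`): a globally minimal `W` with `9 ∣ N` and `ord₃ j ≥ 0` has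
`1 ≤ ord₃ Δ_min − ord₃ N + 1 ≤ 9`. [cite: SilvermanATAEC1994, IV.9.4 Table 4.1 and IV.11.1] [cite: Kraus1990, Thm 1] -/
theorem potGoodComponentWindowThree (W : WeierstrassCurve ℚ) [W.IsElliptic] [W.IsGloballyMinimal]
    (h9 : 3 ^ 2 ∣ W.conductorNorm ℤ) (hj : 0 ≤ padicValRat 3 W.j) :
    1 ≤ ((padicValInt 3 W.minimalDiscriminantInt : ℕ) : ℤ) - (padicValNat 3 (W.conductorNorm ℤ) : ℤ) + 1 ∧
      ((padicValInt 3 W.minimalDiscriminantInt : ℕ) : ℤ) - (padicValNat 3 (W.conductorNorm ℤ) : ℤ) + 1 ≤ 9 := by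
  obtain ⟨heq, hadd⟩ := oggComponents_eq_numComponents_of_sq_dvd W 3 h9
  rw [heq]
  exact ⟨by exact_mod_cast (W.kodairaSymbolAt (placeOf 3)).numComponents_pos,
    by exact_mod_cast numComponents_le_nine_of_potGood_three W hadd hj⟩

/-- **S-an-42′ `PotSupersingularComponentBoundThree` BY VALUE** (an g25, Sketch-an-g25b :57): `9 ∣ N`, `j = 0 ∨ ord₃ j > 0` ⟹
`1 ≤ ord₃ Δ_min − ord₃ N + 1 ≤ 9`. [cite: SilvermanATAEC1994, IV.9.4 Table 4.1 and IV.11.1] -/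
theorem potSupersingularComponentBoundThree (W : WeierstrassCurve ℚ) [W.IsElliptic] [W.IsGloballyMinimal]
    (h9 : 3 ^ 2 ∣ W.conductorNorm ℤ) (hss : W.j = 0 ∨ 0 < padicValRat 3 W.j) :
    1 ≤ ((padicValInt 3 W.minimalDiscriminantInt : ℕ) : ℤ) - (padicValNat 3 (W.conductorNorm ℤ) : ℤ) + 1 ∧
      ((padicValInt 3 W.minimalDiscriminantInt : ℕ) : ℤ) - (padicValNat 3 (W.conductorNorm ℤ) : ℤ) + 1 ≤ 9 := by
  refine potGoodComponentWindowThree W h9 ?_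
  rcases hss with h | h
  · rw [h, padicValRat.zero]
  · exact h.le

/-- **S-an-43 `WildThreeKodairaTypes` BY VALUE** (an g25, Sketch-an-g25 :257; DD15 Thm 6 ⟸ Kraus 1990: wild at `3` ⟹ `II, IV, IV*, II*`):
`27 ∣ N`, `ord₃ j ≥ 0` ⟹ `ord₃ Δ_min − ord₃ N + 1 ∈ {1, 3, 7, 9}` (the `j`-hypothesis is idle: `numComponents_of_twentyseven_dvd`).
[cite: SilvermanATAEC1994, IV.9.4 Table 4.1 and IV.11.1] [cite: DokchitserDokchitser2015LocalInvariants, Thm 6] -/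
theorem wildThreeKodairaTypes (W : WeierstrassCurve ℚ) [W.IsElliptic] [W.IsGloballyMinimal]
    (h27 : 3 ^ 3 ∣ W.conductorNorm ℤ) (_hj : 0 ≤ padicValRat 3 W.j) :
    ((padicValInt 3 W.minimalDiscriminantInt : ℕ) : ℤ) - (padicValNat 3 (W.conductorNorm ℤ) : ℤ) + 1 = 1 ∨
      ((padicValInt 3 W.minimalDiscriminantInt : ℕ) : ℤ) - (padicValNat 3 (W.conductorNorm ℤ) : ℤ) + 1 = 3 ∨
      ((padicValInt 3 W.minimalDiscriminantInt : ℕ) : ℤ) - (padicValNat 3 (W.conductorNorm ℤ) : ℤ) + 1 = 7 ∨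
      ((padicValInt 3 W.minimalDiscriminantInt : ℕ) : ℤ) - (padicValNat 3 (W.conductorNorm ℤ) : ℤ) + 1 = 9 := by
  have h9 : 3 ^ 2 ∣ W.conductorNorm ℤ := (pow_dvd_pow 3 (by norm_num)).trans h27
  rw [(oggComponents_eq_numComponents_of_sq_dvd W 3 h9).1]
  rcases numComponents_of_twentyseven_dvd W h27 with h | h | h | h <;> rw [h] <;> simp

end Summit.BirchSwinnertonDyer.BirchSwinnertonDyer.Theorems.ManinLocalTwoThree

end
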